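import Mathlib
import HarnessLib
import Literature.Probability.Distributions.GaussianMoments

/-!
# `FemtoCurvatureSkewness` — stub `PermanentalRigidity` of line `Sketch-ideator3`
(crux stmt-QuantumFields-9365)

Wick/Isserlis at degree 6 for a centred Gaussian triple `φ_a = ∑ i, M a i ξ_i` (`ξ` iid `𝒩(0,1)`),
Gram matrix `g = M Mᵀ`: `Cov(φ₀², φ₁²) = 2 g₀₁²`, `κ₃(φ₀², φ₁², φ₂²) = 8 g₀₁ g₁₂ g₂₀`
(raw-moment form of the third cumulant; Isserlis 1918 / Wick, cf. Janson, *Gaussian Hilbert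
Spaces* (1997), Thm. 1.28).

Proof by polarization: the law of a linear form `ξ ↦ ∑ sᵢ ξᵢ` under `⊗ 𝒩(0,1)` is `𝒩(0, ∑ sᵢ²)`
(Mathlib's `map_pi_eq_stdGaussian` + `IsGaussian.map_eq_gaussianReal`), its even moments are
`(∑ sᵢ²)^r (2r-1)‼` (tree `integral_pow_even_gaussianReal`), and `x²y²`, `x²y²z²` are rational
combinations of fourth, resp. sixth, powers of linear forms in `x, y, z`.
-/

noncomputable section

namespace Summit.QuantumFields.YangMills.Theorems.FemtoCurvatureSkewness

open MeasureTheory ProbabilityTheory Finset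
open scoped BigOperators Nat

variable {ι : Type*} [Fintype ι]

/-- The law of the linear form `ξ ↦ ∑ sᵢ ξᵢ` under the product standard Gaussian `⊗ᵢ 𝒩(0,1)` is the
centred Gaussian of variance `‖s‖²`. -/
theorem map_linForm_pi_gaussianReal (s : ι → ℝ) :
    (Measure.pi fun _ : ι => gaussianReal 0 1).map (fun ξ => ∑ i, s i * ξ i) =
      gaussianReal 0 (‖(WithLp.toLp 2 s : EuclideanSpace ℝ ι)‖ ^ 2).toNNReal := by
  have hcomp : (fun ξ : ι → ℝ => ∑ i, s i * ξ i) =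
      (innerSL ℝ (WithLp.toLp 2 s : EuclideanSpace ℝ ι) : EuclideanSpace ℝ ι → ℝ) ∘
        (WithLp.toLp 2 : (ι → ℝ) → EuclideanSpace ℝ ι) := by
    funext ξ
    simp [EuclideanSpace.inner_toLp_toLp, dotProduct, mul_comm]
  rw [hcomp, ← Measure.map_map (by fun_prop) (WithLp.measurable_toLp 2 _), map_pi_eq_stdGaussian,
    IsGaussian.map_eq_gaussianReal, integral_strongDual_stdGaussian, variance_dual_stdGaussian,
    innerSL_apply_norm]

/-- Even moments of a linear form under `⊗ᵢ 𝒩(0,1)`: `𝔼[(∑ sᵢ ξᵢ)^{2r}] = (∑ sᵢ²)^r (2r-1)‼`. -/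
theorem integral_linForm_pow_even (s : ι → ℝ) (r : ℕ) :
    ∫ ξ, (∑ i, s i * ξ i) ^ (2 * r) ∂(Measure.pi fun _ : ι => gaussianReal 0 1) =
      (∑ i, s i ^ 2) ^ r * ((2 * r - 1 : ℕ)‼ : ℝ) := by
  have hφ : Measurable (fun ξ : ι → ℝ => ∑ i, s i * ξ i) := by fun_prop
  have hf : AEStronglyMeasurable (fun x : ℝ => x ^ (2 * r))
      ((Measure.pi fun _ : ι => gaussianReal 0 1).map (fun ξ : ι → ℝ => ∑ i, s i * ξ i)) :=
    (measurable_id.pow_const _).aestronglyMeasurable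
  rw [← integral_map hφ.aemeasurable hf, map_linForm_pi_gaussianReal,
    Literature.Probability.Distributions.integral_pow_even_gaussianReal,
    Real.coe_toNNReal _ (by positivity), EuclideanSpace.real_norm_sq_eq]

/-- Powers of a linear form are integrable under `⊗ᵢ 𝒩(0,1)`. -/
theorem integrable_linForm_pow (s : ι → ℝ) (n : ℕ) :
    Integrable (fun ξ : ι → ℝ => (∑ i, s i * ξ i) ^ n)
      (Measure.pi fun _ : ι => gaussianReal 0 1) := by
  have hφ : Measurable (fun ξ : ι → ℝ => ∑ i, s i * ξ i) := by fun_prop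
  have h := Literature.Probability.Distributions.integrable_pow_gaussianReal 0
    ((‖(WithLp.toLp 2 s : EuclideanSpace ℝ ι)‖ ^ 2).toNNReal) n
  rw [← map_linForm_pi_gaussianReal s] at h
  exact h.comp_measurable hφ

/-- A combination of three linear forms is the linear form of the combined coefficients. -/
theorem linForm_comb (u v w : ι → ℝ) (a b c : ℝ) (ξ : ι → ℝ) :
    a * (∑ i, u i * ξ i) + b * (∑ i, v i * ξ i) + c * (∑ i, w i * ξ i) =
      ∑ i, (a * u i + b * v i + c * w i) * ξ i := by
  simp only [Finset.mul_sum, ← Finset.sum_add_distrib]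
  exact Finset.sum_congr rfl fun i _ => by ring

/-- The squared norm of combined coefficients in terms of the Gram entries. -/
theorem sum_sq_comb (u v w : ι → ℝ) (a b c : ℝ) :
    ∑ i, (a * u i + b * v i + c * w i) ^ 2 =
      a ^ 2 * (∑ i, u i * u i) + b ^ 2 * (∑ i, v i * v i) + c ^ 2 * (∑ i, w i * w i) +
        2 * a * b * (∑ i, u i * v i) + 2 * a * c * (∑ i, u i * w i) +
        2 * b * c * (∑ i, v i * w i) := by
  simp only [Finset.mul_sum, ← Finset.sum_add_distrib]
  exact Finset.sum_congr rfl fun i _ => by ring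

/-- Even moments of a combination of three linear forms under `⊗ᵢ 𝒩(0,1)`. -/
theorem integral_comb_pow_even (u v w : ι → ℝ) (a b c : ℝ) (r : ℕ) :
    ∫ ξ, (a * (∑ i, u i * ξ i) + b * (∑ i, v i * ξ i) + c * (∑ i, w i * ξ i)) ^ (2 * r)
        ∂(Measure.pi fun _ : ι => gaussianReal 0 1) =
      (a ^ 2 * (∑ i, u i * u i) + b ^ 2 * (∑ i, v i * v i) + c ^ 2 * (∑ i, w i * w i) +
          2 * a * b * (∑ i, u i * v i) + 2 * a * c * (∑ i, u i * w i) +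
          2 * b * c * (∑ i, v i * w i)) ^ r * ((2 * r - 1 : ℕ)‼ : ℝ) := by
  simp_rw [linForm_comb]
  rw [integral_linForm_pow_even, sum_sq_comb]

/-- Powers of a combination of three linear forms are integrable under `⊗ᵢ 𝒩(0,1)`. -/
theorem integrable_comb_pow (u v w : ι → ℝ) (a b c : ℝ) (n : ℕ) :
    Integrable (fun ξ : ι → ℝ =>
      (a * (∑ i, u i * ξ i) + b * (∑ i, v i * ξ i) + c * (∑ i, w i * ξ i)) ^ n)
      (Measure.pi fun _ : ι => gaussianReal 0 1) := by
  simp_rw [linForm_comb]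
  exact integrable_linForm_pow _ n

/-- Second moment: `𝔼[(a X + b Y + c Z)²]` equals the Gram quadratic form. -/
theorem integral_comb_pow_two (u v w : ι → ℝ) (a b c : ℝ) :
    ∫ ξ, (a * (∑ i, u i * ξ i) + b * (∑ i, v i * ξ i) + c * (∑ i, w i * ξ i)) ^ 2
        ∂(Measure.pi fun _ : ι => gaussianReal 0 1) =
      a ^ 2 * (∑ i, u i * u i) + b ^ 2 * (∑ i, v i * v i) + c ^ 2 * (∑ i, w i * w i) +
        2 * a * b * (∑ i, u i * v i) + 2 * a * c * (∑ i, u i * w i) +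
        2 * b * c * (∑ i, v i * w i) := by
  have h := integral_comb_pow_even u v w a b c 1
  norm_num [Nat.doubleFactorial] at h
  rw [h]

/-- Fourth moment: `𝔼[(a X + b Y + c Z)⁴] = 3 q²` with `q` the Gram quadratic form. -/
theorem integral_comb_pow_four (u v w : ι → ℝ) (a b c : ℝ) :
    ∫ ξ, (a * (∑ i, u i * ξ i) + b * (∑ i, v i * ξ i) + c * (∑ i, w i * ξ i)) ^ 4
        ∂(Measure.pi fun _ : ι => gaussianReal 0 1) =
      3 * (a ^ 2 * (∑ i, u i * u i) + b ^ 2 * (∑ i, v i * v i) + c ^ 2 * (∑ i, w i * w i) +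
        2 * a * b * (∑ i, u i * v i) + 2 * a * c * (∑ i, u i * w i) +
        2 * b * c * (∑ i, v i * w i)) ^ 2 := by
  have h := integral_comb_pow_even u v w a b c 2
  norm_num [Nat.doubleFactorial] at h
  rw [h, mul_comm]

/-- Sixth moment: `𝔼[(a X + b Y + c Z)⁶] = 15 q³` with `q` the Gram quadratic form. -/
theorem integral_comb_pow_six (u v w : ι → ℝ) (a b c : ℝ) :
    ∫ ξ, (a * (∑ i, u i * ξ i) + b * (∑ i, v i * ξ i) + c * (∑ i, w i * ξ i)) ^ 6
        ∂(Measure.pi fun _ : ι => gaussianReal 0 1) =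
      15 * (a ^ 2 * (∑ i, u i * u i) + b ^ 2 * (∑ i, v i * v i) + c ^ 2 * (∑ i, w i * w i) +
        2 * a * b * (∑ i, u i * v i) + 2 * a * c * (∑ i, u i * w i) +
        2 * b * c * (∑ i, v i * w i)) ^ 3 := by
  have h := integral_comb_pow_even u v w a b c 3
  norm_num [Nat.doubleFactorial] at h
  rw [h, mul_comm]

/-- `𝔼[X²] = ⟨u, u⟩` for the linear form `X = ∑ uᵢ ξᵢ`. -/
theorem integral_linForm_sq (u v w : ι → ℝ) :
    ∫ ξ, (∑ i, u i * ξ i) ^ 2 ∂(Measure.pi fun _ : ι => gaussianReal 0 1) = ∑ i, u i * u i := by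
  have h := integral_comb_pow_two u v w 1 0 0
  have hpt : ∀ ξ : ι → ℝ, (∑ i, u i * ξ i) ^ 2 =
      (1 * (∑ i, u i * ξ i) + 0 * (∑ i, v i * ξ i) + 0 * (∑ i, w i * ξ i)) ^ 2 := fun ξ => by ring
  simp_rw [hpt]
  rw [h]
  ring

/-- **Isserlis at order four** for two linear forms: `𝔼[X² Y²] = ⟨u,u⟩⟨v,v⟩ + 2⟨u,v⟩²`
(polarization `x²y² = ((x+y)⁴ + (x-y)⁴ - 2x⁴ - 2y⁴)/12`). -/
theorem integral_linForm_sq_mul_sq (u v w : ι → ℝ) :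
    ∫ ξ, (∑ i, u i * ξ i) ^ 2 * (∑ i, v i * ξ i) ^ 2 ∂(Measure.pi fun _ : ι => gaussianReal 0 1) =
      (∑ i, u i * u i) * (∑ i, v i * v i) + 2 * (∑ i, u i * v i) ^ 2 := by
  let T : Fin 4 → Fin 3 → ℝ := ![![1, 1, 0], ![1, -1, 0], ![1, 0, 0], ![0, 1, 0]]
  let c : Fin 4 → ℝ := ![1, 1, -2, -2]
  let F : Fin 4 → (ι → ℝ) → ℝ := fun k ξ =>
    c k * (T k 0 * (∑ i, u i * ξ i) + T k 1 * (∑ i, v i * ξ i) + T k 2 * (∑ i, w i * ξ i)) ^ 4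
  have hpt : ∀ ξ : ι → ℝ,
      (∑ i, u i * ξ i) ^ 2 * (∑ i, v i * ξ i) ^ 2 = (1 / 12 : ℝ) * ∑ k, F k ξ := by
    intro ξ
    simp [F, T, c, Fin.sum_univ_succ]
    ring
  have hint : ∀ k ∈ Finset.univ, Integrable (F k) (Measure.pi fun _ : ι => gaussianReal 0 1) :=
    fun k _ => (integrable_comb_pow u v w (T k 0) (T k 1) (T k 2) 4).const_mul (c k)
  simp_rw [hpt]
  rw [integral_const_mul, integral_finsetSum _ hint]
  simp only [F, integral_const_mul, integral_comb_pow_four]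
  simp [T, c, Fin.sum_univ_succ]
  ring

/-- **Isserlis at order six** for three linear forms:
`𝔼[X² Y² Z²] = ⟨u,u⟩⟨v,v⟩⟨w,w⟩ + 2(⟨u,v⟩²⟨w,w⟩ + ⟨u,w⟩²⟨v,v⟩ + ⟨v,w⟩²⟨u,u⟩) + 8⟨u,v⟩⟨v,w⟩⟨u,w⟩`
(polarization of `x²y²z²` into thirteen sixth powers of linear forms). -/
theorem integral_linForm_sq_mul_sq_mul_sq (u v w : ι → ℝ) :
    ∫ ξ, (∑ i, u i * ξ i) ^ 2 * (∑ i, v i * ξ i) ^ 2 * (∑ i, w i * ξ i) ^ 2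
        ∂(Measure.pi fun _ : ι => gaussianReal 0 1) =
      (∑ i, u i * u i) * (∑ i, v i * v i) * (∑ i, w i * w i) +
        2 * ((∑ i, u i * v i) ^ 2 * (∑ i, w i * w i) + (∑ i, u i * w i) ^ 2 * (∑ i, v i * v i) +
          (∑ i, v i * w i) ^ 2 * (∑ i, u i * u i)) +
        8 * (∑ i, u i * v i) * (∑ i, v i * w i) * (∑ i, u i * w i) := by
  let T : Fin 13 → Fin 3 → ℝ :=
    ![![1, 1, 1], ![1, 1, -1], ![1, -1, 1], ![1, -1, -1], ![1, 1, 0], ![1, -1, 0], ![0, 1, 1],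
      ![0, 1, -1], ![1, 0, 1], ![1, 0, -1], ![1, 0, 0], ![0, 1, 0], ![0, 0, 1]]
  let c : Fin 13 → ℝ := ![1, 1, 1, 1, -2, -2, -2, -2, -2, -2, 4, 4, 4]
  let F : Fin 13 → (ι → ℝ) → ℝ := fun k ξ =>
    c k * (T k 0 * (∑ i, u i * ξ i) + T k 1 * (∑ i, v i * ξ i) + T k 2 * (∑ i, w i * ξ i)) ^ 6
  have hpt : ∀ ξ : ι → ℝ, (∑ i, u i * ξ i) ^ 2 * (∑ i, v i * ξ i) ^ 2 * (∑ i, w i * ξ i) ^ 2 =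
      (1 / 360 : ℝ) * ∑ k, F k ξ := by
    intro ξ
    simp [F, T, c, Fin.sum_univ_succ]
    ring
  have hint : ∀ k ∈ Finset.univ, Integrable (F k) (Measure.pi fun _ : ι => gaussianReal 0 1) :=
    fun k _ => (integrable_comb_pow u v w (T k 0) (T k 1) (T k 2) 6).const_mul (c k)
  simp_rw [hpt]
  rw [integral_const_mul, integral_finsetSum _ hint]
  simp only [F, integral_const_mul, integral_comb_pow_six]
  simp [T, c, Fin.sum_univ_succ]
  ring

/-- The Gram matrix entries: `(M Mᵀ) a b = ∑ i, M a i * M b i`. -/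
theorem gram_apply {m : ℕ} (M : Matrix (Fin 3) (Fin m) ℝ) (a b : Fin 3) :
    (M * M.transpose) a b = ∑ i, M a i * M b i := by
  simp [Matrix.mul_apply]

/-- **Permanental rigidity** (stub `PermanentalRigidity`, registered signature verbatim). -/
theorem PermanentalRigidity :
  ∀ (m : ℕ) (M : Matrix (Fin 3) (Fin m) ℝ),
    (∫ ξ, (∑ i, M 0 i * ξ i) ^ 2 * (∑ i, M 1 i * ξ i) ^ 2 ∂Measure.pi fun _ : Fin m => gaussianReal 0 1) -
          (∫ ξ, (∑ i, M 0 i * ξ i) ^ 2 ∂Measure.pi fun _ : Fin m => gaussianReal 0 1) *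
            (∫ ξ, (∑ i, M 1 i * ξ i) ^ 2 ∂Measure.pi fun _ : Fin m => gaussianReal 0 1) =
        2 * ((M * M.transpose) 0 1) ^ 2 ∧
      (∫ ξ, (∑ i, M 0 i * ξ i) ^ 2 * (∑ i, M 1 i * ξ i) ^ 2 * (∑ i, M 2 i * ξ i) ^ 2 ∂Measure.pi fun _ : Fin m => gaussianReal 0 1) -
            (∫ ξ, (∑ i, M 0 i * ξ i) ^ 2 ∂Measure.pi fun _ : Fin m => gaussianReal 0 1) *
              (∫ ξ, (∑ i, M 1 i * ξ i) ^ 2 * (∑ i, M 2 i * ξ i) ^ 2 ∂Measure.pi fun _ : Fin m => gaussianReal 0 1) -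
            (∫ ξ, (∑ i, M 1 i * ξ i) ^ 2 ∂Measure.pi fun _ : Fin m => gaussianReal 0 1) *
              (∫ ξ, (∑ i, M 0 i * ξ i) ^ 2 * (∑ i, M 2 i * ξ i) ^ 2 ∂Measure.pi fun _ : Fin m => gaussianReal 0 1) -
            (∫ ξ, (∑ i, M 2 i * ξ i) ^ 2 ∂Measure.pi fun _ : Fin m => gaussianReal 0 1) *
              (∫ ξ, (∑ i, M 0 i * ξ i) ^ 2 * (∑ i, M 1 i * ξ i) ^ 2 ∂Measure.pi fun _ : Fin m => gaussianReal 0 1) +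
          2 * ((∫ ξ, (∑ i, M 0 i * ξ i) ^ 2 ∂Measure.pi fun _ : Fin m => gaussianReal 0 1) *
            (∫ ξ, (∑ i, M 1 i * ξ i) ^ 2 ∂Measure.pi fun _ : Fin m => gaussianReal 0 1) *
            (∫ ξ, (∑ i, M 2 i * ξ i) ^ 2 ∂Measure.pi fun _ : Fin m => gaussianReal 0 1)) =
        8 * (M * M.transpose) 0 1 * (M * M.transpose) 1 2 * (M * M.transpose) 2 0 := by
  intro m M
  rw [integral_linForm_sq_mul_sq_mul_sq (M 0) (M 1) (M 2),
    integral_linForm_sq_mul_sq (M 0) (M 1) (M 2), integral_linForm_sq_mul_sq (M 1) (M 2) (M 0),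
    integral_linForm_sq_mul_sq (M 0) (M 2) (M 1), integral_linForm_sq (M 0) (M 1) (M 2),
    integral_linForm_sq (M 1) (M 2) (M 0), integral_linForm_sq (M 2) (M 0) (M 1)]
  simp only [gram_apply]
  have h20 : ∑ i, M 2 i * M 0 i = ∑ i, M 0 i * M 2 i := Finset.sum_congr rfl fun i _ => mul_comm _ _
  rw [h20]
  constructor <;> ring

end Summit.QuantumFields.YangMills.Theorems.FemtoCurvatureSkewness

end
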